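import Mathlib
import Summits.ValiantsHypothesis.ValiantsHypothesis.Theorems.NewtonUnitEquationsDissociatedUniformTotalsLaw
import HarnessLib

/-!
# Crux `NewtonUnitEquations.DissociatedUniform` (stmt-ValiantsHypothesis-5905): totals law — SERVERS of the classes at a fixed direction (partition and pinning)

Bookkeeping behind the server / multiplicity decomposition of the `n = 3` totals `T` (memo `Cruxes/DissociatedUniform/NOTES-t1g12.md` §3),
in the style of `…TotalsLaw.le_of_wins_all` (memo NOTES-d1g3 §2 L5).  At a fixed direction write `F r` for the support value of the fibre
`P_r` and `γ z` for the score of the letter `c z`.  Class `s` is the union of the blobs `P_r + c z`, `r + z = s`, and its top value is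
`max_r (F r + γ (s - r))`; say the split `(r, z)` SERVES class `r + z` if `F r' + γ (z + r - r') ≤ F r + γ z` for every `r'` (the competitor
of class `r + z` sitting over the fibre `r'` has the letter `z + r - r'`).  PROVED (pure bookkeeping over the group, any `F γ : G → ℝ`):
* `exists_server` — every class is served by some split; **`card_le_sum_card_servers`** — `|G| ≤ ∑_r #{z : (r, z) serves r + z}` (one
  server per class; with strict maxima this is the partition identity `∑_r |D_r| = |G|` of the memo);
* **`server_pinning`** — if `(r, z)` and `(r, z')` both serve (the same fibre serves two classes) then, with `t = z' - z`,
  `F (r - t) - F r ≤ γ z - γ z' ≤ F r - F (r + t)`: the score difference of the two letters is PINNED between the height drops of the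
  fibre towards `r ∓ t`; hence `midpoint_dominant_of_serves_two` — `F (r - t) + F (r + t) ≤ 2 F r` (a fibre serving two classes whose
  letters differ by `t` dominates the midpoint of `r ± t`), and `eq_of_serves_of_strict_valley` — a fibre lying strictly below the average of
  `r - t, r + t` for every `t ≠ 0` serves at most one class.  (`le_of_wins_all` is the case of a fibre serving every class.)
Honest label: tool lemmas; `TotalsLawThree` remains OPEN; nothing here bears on VP ≠ VNP.
[folklore: exchange inequalities for (max,+) convolution]
-/

set_option linter.dupNamespace false -- `ValiantsHypothesis.ValiantsHypothesis` (summit = problem) in every name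

open scoped BigOperators

namespace Summit.ValiantsHypothesis.ValiantsHypothesis.Theorems.NewtonUnitEquationsDissociatedUniform

namespace TotalsLaw

section Servers

variable {G : Type*} [AddCommGroup G] [Fintype G]

/-- **Every class has a server**: for every class `s` some split `(r, s - r)` maximises `F r + γ (s - r)`, i.e. serves `s`. [folklore] -/
theorem exists_server (F γ : G → ℝ) (s : G) :
    ∃ r : G, ∀ r' : G, F r' + γ ((s - r) + r - r') ≤ F r + γ (s - r) := by
  classical
  obtain ⟨r, -, hr⟩ := Finset.exists_max_image (Finset.univ : Finset G) (fun r => F r + γ (s - r)) Finset.univ_nonempty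
  refine ⟨r, fun r' => ?_⟩
  rw [show s - r + r - r' = s - r' by abel]
  exact hr r' (Finset.mem_univ _)

open Classical in
/-- **One server per class**: `|G| ≤ ∑_r #{z : (r, z) serves the class r + z}` — the class `s ↦` (a serving fibre `r(s)`, letter `s - r(s)`)
is injective since `r + z` recovers `s`.  (With strict maxima every class has exactly one server and equality holds: the partition identity
`∑_r |D_r| = |G|` of the memo.) [folklore] -/
theorem card_le_sum_card_servers (F γ : G → ℝ) :
    Fintype.card G ≤ ∑ r : G, ((Finset.univ : Finset G).filter fun z => ∀ r' : G, F r' + γ (z + r - r') ≤ F r + γ z).card := by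
  classical
  -- choose a server for every class
  have hch : ∀ s : G, ∃ r : G, ∀ r' : G, F r' + γ ((s - r) + r - r') ≤ F r + γ (s - r) := exists_server F γ
  choose ρ hρ using hch
  -- the sigma set of all (fibre, served letter) pairs
  set S : Finset (Σ _ : G, G) := (Finset.univ : Finset G).sigma fun r =>
    (Finset.univ : Finset G).filter fun z => ∀ r' : G, F r' + γ (z + r - r') ≤ F r + γ z with hS
  have hcardS : S.card = ∑ r : G, ((Finset.univ : Finset G).filter fun z =>
      ∀ r' : G, F r' + γ (z + r - r') ≤ F r + γ z).card := by
    rw [hS, Finset.card_sigma]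
  rw [← hcardS, ← Finset.card_univ]
  refine Finset.card_le_card_of_injOn (fun s => (⟨ρ s, s - ρ s⟩ : Σ _ : G, G)) (fun s _ => ?_) ?_
  · rw [Finset.mem_coe, hS, Finset.mem_sigma]
    exact ⟨Finset.mem_univ _, Finset.mem_filter.2 ⟨Finset.mem_univ _, hρ s⟩⟩
  · intro s _ s' _ h
    simp only [Sigma.mk.injEq] at h
    obtain ⟨h1, h2⟩ := h
    have h2' : s - ρ s = s' - ρ s' := eq_of_heq h2
    rw [h1] at h2'
    exact sub_left_injective h2'

omit [Fintype G] in
/-- **Pinning lemma.**  If the fibre `r` serves both `z` and `z'` then, with `t = z' - z`,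
`F (r - t) - F r ≤ γ z - γ z' ≤ F r - F (r + t)`: compare `(r, z)` with the competitor `(r - t, z')` of its class and `(r, z')` with the
competitor `(r + t, z)` of its class. [folklore] -/
theorem server_pinning (F γ : G → ℝ) {r z z' : G}
    (hz : ∀ r' : G, F r' + γ (z + r - r') ≤ F r + γ z) (hz' : ∀ r' : G, F r' + γ (z' + r - r') ≤ F r + γ z') :
    F (r - (z' - z)) - F r ≤ γ z - γ z' ∧ γ z - γ z' ≤ F r - F (r + (z' - z)) := by
  constructor
  · have h := hz (r - (z' - z))
    rw [show z + r - (r - (z' - z)) = z' by abel] at h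
    linarith
  · have h := hz' (r + (z' - z))
    rw [show z' + r - (r + (z' - z)) = z by abel] at h
    linarith

omit [Fintype G] in
/-- **Midpoint dominance.**  A fibre serving two classes whose letters differ by `t = z' - z` satisfies `F (r - t) + F (r + t) ≤ 2 F r`.
[folklore] -/
theorem midpoint_dominant_of_serves_two (F γ : G → ℝ) {r z z' : G}
    (hz : ∀ r' : G, F r' + γ (z + r - r') ≤ F r + γ z) (hz' : ∀ r' : G, F r' + γ (z' + r - r') ≤ F r + γ z') :
    F (r - (z' - z)) + F (r + (z' - z)) ≤ 2 * F r := by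
  obtain ⟨h1, h2⟩ := server_pinning F γ hz hz'
  linarith

omit [Fintype G] in
/-- **Strict valleys serve at most one class.**  If `2 F r < F (r - t) + F (r + t)` for every `t ≠ 0` (the fibre `r` lies strictly below the
average of its two `t`-neighbours in every direction `t`), then all classes served by `r` use the same letter. [folklore] -/
theorem eq_of_serves_of_strict_valley (F γ : G → ℝ) {r : G} (hval : ∀ t : G, t ≠ 0 → 2 * F r < F (r - t) + F (r + t))
    {z z' : G} (hz : ∀ r' : G, F r' + γ (z + r - r') ≤ F r + γ z) (hz' : ∀ r' : G, F r' + γ (z' + r - r') ≤ F r + γ z') :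
    z = z' := by
  by_contra hne
  have ht : z' - z ≠ 0 := sub_ne_zero.2 (Ne.symm hne)
  have h := midpoint_dominant_of_serves_two F γ hz hz'
  linarith [hval (z' - z) ht]

omit [Fintype G] in
/-- **A served letter beats its translates by the height deficits.**  If `(r, z)` serves and the fibre `r'` is higher than `r` by `d`
(`F r + d ≤ F r'`), then the letter `z` beats the letter `z + r - r'` by at least `d`: `γ (z + r - r') + d ≤ γ z`.  (So a fibre at depth `d`
below another can only serve letters that beat a specific translate by `d`.) [folklore] -/
theorem letter_gap_of_serves (F γ : G → ℝ) {r z r' : G} {d : ℝ}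
    (hz : ∀ r' : G, F r' + γ (z + r - r') ≤ F r + γ z) (hd : F r + d ≤ F r') : γ (z + r - r') + d ≤ γ z := by
  have h := hz r'
  linarith

end Servers

end TotalsLaw

end Summit.ValiantsHypothesis.ValiantsHypothesis.Theorems.NewtonUnitEquationsDissociatedUniform
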